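import Summits.QuantumFields.BalabanUV.T4Continuum.Support.DirichletSubregionDefect
import Summits.QuantumFields.BalabanUV.T4Continuum.Support.RegionGaugeFixedVectorFlat
import Summits.QuantumFields.BalabanUV.T4Continuum.Support.ScalarBlockTrialFunction
import Summits.QuantumFields.BalabanUV.T4Continuum.Support.ScalarPlantingDefect

/-!
# T⁴ programme, spine node NE2 (U1a), sub-row Δ1 «NE2⁰-Dirichlet» — THE Ω-RESTRICTED TOWER OF THE [B9]-FAITHFUL `U = 1` STAR-BOND
# VECTOR OPERATOR `Δ_a(Ω₀)`: `FreeTowerLaws` / `TowerLimitRate` for `k ↦ regionDeltaA (lev L k) M a a′ S` with King's averaging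
# compressed to the star bonds, MODULO one displayed slice inequality per level (W1), the LEVEL-DEPENDENT gradient-form bound (W2)
# and the injected law (W3) — downward closure, exposed faces and the pairing-defect majorant PROVED

Thirteenth generation of the NE2 prover lineage P1 of the cell `pub-balaban` (row NE2 owner), file 2 (owner item O13-a = O12-g′,
rulings R23/R24: the INSTANCE half on the crew's Δ1-COERC instance `Support/RegionGaugeFixedVector` p223093, leaf-07 gen 5; generic
half = files 1a/1b `Support/DirichletSubregionTowerOf` / `Support/DirichletSubregionDefect`).  Located obstruction G-ne2p1-g12-3: the STAR
bonds `starReg n M S = {(x,ν) : x ∈ Ω ∨ x + e_ν ∈ Ω}` of `Ω = blockReg n M S` are NOT a union of blocks in King's (site × component)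
indexing, so gen 11/12's region tower (`ridx`, exact pairing) does not carry `regionDeltaA`.  THIS FILE puts `regionDeltaA` on the
DOWNWARD-CLOSED sub-carrier tower of files 1a/1b and proves the geometric inputs:
 * §0–§1 block geometry and DOWNWARD CLOSURE `star_down` (a level-`(k+1)` star bond has a level-`k` star parent: `blockOf_par`,
   `par_add_unitVec`); EXPOSED FACES `star_exposed`: at every level with `2 ≤ lev L k` a DEFICIENT star bond `(x,ν)` has `x ∉ Ω`, so
   `x + e_ν ∈ Ω`, so `x` is in the last `ν`-layer of its unit block (`digit_eq_of_blockOf_ne`), so `x − e_ν` is in the same block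
   (`blockOf_sub_unitVec`) and `(x − e_ν, ν) ∉ STAR`;
 * §2 W1 PER LEVEL from ONE displayed slice inequality: `coercive_regionDeltaA_of_slice` (leaf-07's `coercive_gaugeFixed_of_slice` ∘
   `sliceData_region`), `γ⋆ = gamStar d a′ c = min(c/2, γ′/2)`, `γ′ = gammaPs d a′`; `regionDeltaA_isHermitian`;
 * §3 THE ENDs: the defect majorant `fStar` (`γ⋆⁻¹` at level 0, `√(d·Cg k·γ⋆⁻¹)·L^{−k}` at `k ≥ 1`) DISCHARGED (`opNorm_FstarR_mul_inv_le`);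
   **`freeTowerLaws_star_of (hL) (ha′) (hc) (hS) (hCg) (hgrad) (hinj)`**: `FreeTowerLaws (k ↦ regionDeltaA (lev L k) M a a′ S) Q⋆ J⋆ F⋆ L^d
   (2d√(Cg (k+1)·γ⋆⁻¹)·L^{−k}) e₁ fStar`; **`towerLimitRate_star_of`** (any geometric rate majorising the three sequences), `_perturbed_of`;
   **`towerLimitRate_star_of_linear`**: under LINEAR GROWTH `Cg k ≤ Cg₀·L^k` of the W2 constant and an injected law at rate `θ`,
   `(√L)⁻¹ ≤ θ < 1`, convergence at rate `θ` with explicit constants.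

WHY W2 IS LEVEL-DEPENDENT (located; numerics in leaf-07-g5's `t4/T4-EST-NE2-D1-COERC.md`, and this exact mode): on a slab `Ω` the
CONSTANT NORMAL field `A = e_ν` on the star bonds has `curlR A = 0` and region divergence `0` (inward and outward boundary bonds are
both star bonds and carry the same value), so `⟨A, Δ_a(Ω₀)A⟩ = a·n^d‖QA‖² ≍ ‖A‖²`, while its ZERO-EXTENSION jumps across `∂Ω`:
`Σ_μ ‖∇_μ ext A‖² ≍ n·‖A‖²/width`.  So the W2 constant w.r.t. the zero-extension norm grows at least like `n = L^k`, `‖G_{k+1}(1 − Π)‖` is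
of order `L^{−(k+1)/2}` on that mode, and the natural class is `Cg k ≤ Cg₀·L^k` (rate `(√L)⁻¹` for the complement and defect sequences).
DISPLAYED inputs: (W1) `SliceCoercive … (a·n_k^d) c` with ONE `c` for all `k` — the crew's located open estimate (discrete Gaffney/Maxwell
gap for the electric realisation, uniformly in `η` and the region); (W2) the gradient-form bound with its level-dependent constant; (W3) `hinj`.

HONEST FRAMING (T4-DAG p. 1).  `U = 1`; ONE region (a decidable set `S` of unit blocks), ONE averaging scale inside `regionDeltaA`
(no `{Λ_j, a_j}`), King's componentwise averaging compressed to star bonds (not Bałaban's contour averaging); finite torus; linear layer;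
operator norm; statements / conventions / constants OURS ([folklore]; `[cite:]` tags locate SHAPES); W1–W3 DISPLAYED, not proved; NOT [B9]
(3.23)–(3.27) as printed; NE2 (U1a) NOT proved; spine 0/9 unchanged; NOT infinite volume, NOT a mass gap, NOT the Clay problem, NOT summit
progress.  HONEST DEPENDENCY: continuum YM on T⁴ ⇐ BetaPertH ∧ nine spine estimates (0/9 proved); BetaPertH ⇐ (D1) ∧ (D4) ∧ CAP+tail; G-an2-4 gates asym, D1 and NE2/3/4.  No `sorry`.
-/

noncomputable section

open scoped BigOperators ComplexConjugate Matrix Matrix.Norms.L2Operator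

namespace Summit.QuantumFields.BalabanUV.T4Continuum.DirichletStarVectorTower

open Literature.MathematicalPhysics.QuantumFieldTheory.Balaban1983to89.B5Prop11Plancherel (Tor fine fdiff unitVec)
open Literature.MathematicalPhysics.QuantumFieldTheory.Balaban1983to89.B5Prop11Lower (nsq nsq_nonneg)
open Literature.MathematicalPhysics.QuantumFieldTheory.Balaban1983to89.B5G183RateUnitTower (lev)
open Literature.MathematicalPhysics.QuantumFieldTheory.Balaban1983to89.B5Block118 (bpt)
open Literature.MathematicalPhysics.QuantumFieldTheory.Balaban1983to89.B5Blocks16 (blockOf blockOf_bpt)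
open Summit.QuantumFields.BalabanUV.T4Continuum
open Summit.QuantumFields.BalabanUV.T4Continuum.CovariantAveragingTower (TowerLimitRate)
open Summit.QuantumFields.BalabanUV.T4Continuum.BalabanAveragedTowerUnit (idx Qlev one_le_lev' cast_lev' lev_succ')
open Summit.QuantumFields.BalabanUV.T4Continuum.BalabanAveragedTowerModes (par)
open Summit.QuantumFields.BalabanUV.T4Continuum.BackgroundResolventTower
open Summit.QuantumFields.BalabanUV.T4Continuum.BlockPairingGeometry (parT par_add_unitVec)
open Summit.QuantumFields.BalabanUV.T4Continuum.SubtypeCompression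
open Summit.QuantumFields.BalabanUV.T4Continuum.ScalarBlockTrialFunction (digits digits_bpt bpt_add_unitVec_of_lt)
open Summit.QuantumFields.BalabanUV.T4Continuum.ScalarPlantingDefect (blockOf_par)
open Summit.QuantumFields.BalabanUV.T4Continuum.ScalarAveragedPropagator (gammaPs gammaPs_pos)
open Summit.QuantumFields.BalabanUV.T4Continuum.RegionGaugeSlice (SliceCoercive gaugeFixed_isHermitian coercive_gaugeFixed_of_slice)
open Summit.QuantumFields.BalabanUV.T4Continuum.RegionScalarCompression (QOm GOm GOm_isHermitian)
open Summit.QuantumFields.BalabanUV.T4Continuum.RegionGaugeFixedVector (starReg curlR gradR avgR regionDeltaA sliceData_region)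
open Summit.QuantumFields.BalabanUV.T4Continuum.RegionGaugeFixedVectorFlat (bpt_blockOf_digits)
open Summit.QuantumFields.BalabanUV.T4Continuum.DirichletSubregionTowerOf
open Summit.QuantumFields.BalabanUV.Beta.GAN24.DirichletBoxCompression (DOm opNorm_inv_DOm_le)
open Summit.QuantumFields.BalabanUV.Beta.GAN24.DirichletBoxTrace (blockReg)

variable {d : ℕ}

/-! ## §0 Block geometry on one fine torus: the last layer and the step back -/

section Geometry

variable (n : ℕ) [NeZero n] (M : Fin d → ℕ) [hM : ∀ μ, NeZero (M μ)]

/-- if a `+ν` step LEAVES the block, the site is in the last `ν`-layer: `digit_ν x + 1 = n`. [folklore] -/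
theorem digit_eq_of_blockOf_ne (x : Tor (fine n M)) (ν : Fin d) (h : blockOf n M (x + unitVec (fine n M) ν) ≠ blockOf n M x) :
    (digits n M x ν : ℕ) + 1 = n := by
  by_contra hne
  have hlt : (digits n M x ν : ℕ) + 1 < n := by have := (digits n M x ν).isLt; omega
  apply h
  conv_lhs => rw [← bpt_blockOf_digits n M x]
  rw [bpt_add_unitVec_of_lt n M _ _ ν hlt, blockOf_bpt]

/-- a site in the last `ν`-layer of a block with `≥ 2` layers steps BACK inside its block: `blockOf (x − e_ν) = blockOf x`. [folklore] -/
theorem blockOf_sub_unitVec (hn : 2 ≤ n) (x : Tor (fine n M)) (ν : Fin d) (h : (digits n M x ν : ℕ) + 1 = n) :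
    blockOf n M (x - unitVec (fine n M) ν) = blockOf n M x := by
  have h2 : n - 2 < n := by omega
  set j' : Fin d → Fin n := Function.update (digits n M x) ν ⟨n - 2, h2⟩ with hj'
  have hj'ν : ((j' ν : ℕ)) = n - 2 := by rw [hj', Function.update_self]
  have hlt : (j' ν : ℕ) + 1 < n := by omega
  have hupd : Function.update j' ν ⟨(j' ν : ℕ) + 1, hlt⟩ = digits n M x := by
    funext μ
    by_cases hμ : μ = ν
    · rw [hμ, Function.update_self]
      apply Fin.ext
      show (j' ν : ℕ) + 1 = (digits n M x ν : ℕ)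
      omega
    · rw [Function.update_of_ne hμ, hj', Function.update_of_ne hμ]
  have hstep : bpt n M (blockOf n M x) j' + unitVec (fine n M) ν = x := by
    rw [bpt_add_unitVec_of_lt n M _ j' ν hlt, hupd, bpt_blockOf_digits]
  rw [← eq_sub_of_add_eq hstep, blockOf_bpt]

end Geometry

/-! ## §1 The star sub-carriers along the tower and their downward closure -/

section Star

variable (L : ℕ) [NeZero L] (M : Fin d → ℕ) [hM : ∀ μ, NeZero (M μ)] (S : Tor M → Prop) [DecidablePred S]

/-- the STAR-bond predicate family on the tower indices (`idx L M k` is `Tor (fine (lev L k)) M × Fin d`). [folklore] -/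
abbrev starP (k : ℕ) : idx L M k → Prop := starReg (lev L k) M S

omit [DecidablePred S] in
/-- the unit block of a fine site is the unit block of its parent, read on `blockReg`. [folklore] -/
theorem blockReg_par_iff (k : ℕ) (y : Tor (fine (lev L (k + 1)) M)) :
    blockReg (lev L k) M S (par (lev L k) L M y) ↔ blockReg (lev L (k + 1)) M S y := by
  show S (blockOf (lev L k) M (par (lev L k) L M y)) ↔ S (blockOf (L * lev L k) M y)
  rw [blockOf_par]

omit [DecidablePred S] in
/-- **DOWNWARD CLOSURE**: a level-`(k+1)` star bond has a level-`k` star parent. [folklore] -/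
theorem star_down : ∀ (k : ℕ) (y : idx L M (k + 1)), starP L M S (k + 1) y → starP L M S k (parT (lev L k) L M y) := by
  intro k y hy
  rcases hy with h1 | h2
  · exact Or.inl ((blockReg_par_iff L M S k y.1).mpr h1)
  · have h3 : blockReg (lev L k) M S (par (lev L k) L M (y.1 + unitVec (fine (lev L (k + 1)) M) y.2)) :=
      (blockReg_par_iff L M S k _).mpr h2
    have h4 := par_add_unitVec (lev L k) L M y.2 y.1
    split_ifs at h4 with hdiv
    · right
      show blockReg (lev L k) M S (par (lev L k) L M y.1 + unitVec (fine (lev L k) M) y.2)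
      rw [← h4]; exact h3
    · left
      show blockReg (lev L k) M S (par (lev L k) L M y.1)
      rw [← h4]; exact h3

omit [DecidablePred S] in
/-- **EXPOSED FACES**: at a level whose unit blocks have `≥ 2` fine layers, a deficient star bond `(x, ν)` has `(x − e_ν, ν) ∉ STAR`.
[folklore] -/
theorem star_exposed (k : ℕ) (hk : 2 ≤ lev L k) :
    ∀ i : pidx L M (starP L M S) k, (∃ y : idx L M (k + 1), parT (lev L k) L M y = i.1 ∧ ¬ starP L M S (k + 1) y) →
      ∃ μ : Fin d, ¬ starP L M S k (i.1.1 - unitVec (fine (lev L k) M) μ, i.1.2) := by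
  rintro ⟨⟨x, ν⟩, hstar⟩ ⟨y, hy, hny⟩
  refine ⟨ν, ?_⟩
  have hpar : par (lev L k) L M y.1 = x := congrArg Prod.fst hy
  have hx : ¬ blockReg (lev L k) M S x := by
    intro hx
    rw [← hpar, blockReg_par_iff] at hx
    exact hny (Or.inl hx)
  have hxe : blockReg (lev L k) M S (x + unitVec (fine (lev L k) M) ν) := Or.resolve_left hstar hx
  have hne : blockOf (lev L k) M (x + unitVec (fine (lev L k) M) ν) ≠ blockOf (lev L k) M x := by
    intro h
    exact hx (show S (blockOf (lev L k) M x) by rw [← h]; exact hxe)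
  have hsame := blockOf_sub_unitVec (lev L k) M hk x ν (digit_eq_of_blockOf_ne (lev L k) M x ν hne)
  rintro (h1 | h2)
  · exact hx (show S (blockOf (lev L k) M x) by rw [← hsame]; exact h1)
  · simp only [sub_add_cancel] at h2
    exact hx h2

/-- for `L ≥ 2` every level `k ≥ 1` has `≥ 2` fine layers per unit block. [folklore] -/
theorem two_le_lev_succ (hL : 2 ≤ L) (k : ℕ) : 2 ≤ lev L (k + 1) := by
  rw [lev_succ']
  exact le_trans (by simpa using hL) (Nat.mul_le_mul_left L (one_le_lev' L k))

end Star

/-! ## §2 W1 per level from one slice inequality; hermiticity -/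

section Operator

variable (n : ℕ) [NeZero n] (M : Fin d → ℕ) [hM : ∀ μ, NeZero (M μ)] (a a' : ℝ) (S : Tor M → Prop) [DecidablePred S]

/-- `Δ_a(Ω₀)` is Hermitian. [folklore] -/
theorem regionDeltaA_isHermitian : (regionDeltaA n M a a' S).IsHermitian :=
  gaugeFixed_isHermitian _ _ _ _ _ _ (GOm_isHermitian n M a' S)

/-- the coercivity constant `γ⋆ = min(c/2, γ′/2)` from a slice constant `c`. [folklore] -/
def gamStar (d : ℕ) (a' c : ℝ) : ℝ := min (c / 2) (1 / (2 * (gammaPs d a')⁻¹))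

/-- `γ⋆ > 0`. [folklore] -/
theorem gamStar_pos {c : ℝ} (hc : 0 < c) : 0 < gamStar d a' c := by
  have hg : 0 < (gammaPs d a')⁻¹ := inv_pos.mpr (gammaPs_pos (d := d) (a' := a')).1
  unfold gamStar
  exact lt_min (by positivity) (by positivity)

/-- **W1 PER LEVEL FROM ONE SLICE INEQUALITY**: `SliceCoercive … (a·n^d) c` ⟹ `Coercive (regionDeltaA n M a a′ S) γ⋆`.
[cite: Balaban1985BackgroundPropagators, (3.27) p.395 (shape: existence of G(Ω₀))] [folklore] -/
theorem coercive_regionDeltaA_of_slice (ha' : 0 < a') {c : ℝ} (hc : 0 < c)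
    (hS : SliceCoercive (curlR n M S) (gradR n M S) (GOm n M a' S) (QOm n M S) (avgR n M S) (a * (n : ℝ) ^ d) c) :
    Coercive (regionDeltaA n M a a' S) (gamStar d a' c) :=
  coercive_gaugeFixed_of_slice _ (sliceData_region n M a' S ha') hc hS (opNorm_inv_DOm_le n M a' (blockReg n M S) ha')
    (inv_pos.mpr (gammaPs_pos (d := d) (a' := a')).1)

end Operator

/-! ## §3 The ENDs: the star tower of `Δ_a(Ω₀)` modulo W1–W3 -/

section End

variable (L : ℕ) [NeZero L] (M : Fin d → ℕ) [hM : ∀ μ, NeZero (M μ)] (a a' : ℝ) (S : Tor M → Prop) [DecidablePred S]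

/-- THE DEFECT MAJORANT of the star tower: `γ⋆⁻¹` at level `0` (no exposed face is guaranteed on the unit lattice), and
`√(d·Cg k·γ⋆⁻¹)·L^{−k}` at levels `k ≥ 1`. [folklore] -/
def fStar (L d : ℕ) (γ : ℝ) (Cg : ℕ → ℝ) : ℕ → ℝ
  | 0 => γ⁻¹
  | k + 1 => Real.sqrt (d * Cg (k + 1) * γ⁻¹) * ((L : ℝ) ^ (k + 1))⁻¹

/-- **THE DEFECT MAJORANT DISCHARGED** for the star tower (W1 at every level, W2 at levels `k ≥ 1`, exposed faces for `L ≥ 2`). [folklore] -/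
theorem opNorm_FstarR_mul_inv_le (hL : 2 ≤ L) (ha' : 0 < a') {c : ℝ} (hc : 0 < c)
    (hS : ∀ k, SliceCoercive (curlR (lev L k) M S) (gradR (lev L k) M S) (GOm (lev L k) M a' S) (QOm (lev L k) M S)
      (avgR (lev L k) M S) (a * ((lev L k : ℕ) : ℝ) ^ d) c)
    {Cg : ℕ → ℝ} (hCg : ∀ k, 0 ≤ Cg k)
    (hgrad : ∀ (k : ℕ) (ν : Fin d) (w : pidx L M (starP L M S) k → ℂ),
      nsq (fdiff (fine (lev L k) M) ((lev L k : ℕ) : ℂ) ν *ᵥ ext (starP L M S k) w)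
        ≤ Cg k * (star w ⬝ᵥ (regionDeltaA (lev L k) M a a' S *ᵥ w)).re) (k : ℕ) :
    ‖FpR L M (starP L M S) k * (regionDeltaA (lev L k) M a a' S)⁻¹‖ ≤ fStar L d (gamStar d a' c) Cg k := by
  have hγ := gamStar_pos (d := d) a' hc
  cases k with
  | zero =>
      simp only [fStar]
      exact opNorm_FpR_mul_inv_le L M (starP L M S) (fun k => regionDeltaA (lev L k) M a a' S) 0 hγ
        (coercive_regionDeltaA_of_slice (lev L 0) M a a' S ha' hc (hS 0))
  | succ k =>
      simp only [fStar]
      exact opNorm_FpR_mul_inv_le_of_exposed L M (starP L M S) (fun k => regionDeltaA (lev L k) M a a' S) (k + 1) hγ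
        (hCg (k + 1)) (coercive_regionDeltaA_of_slice (lev L (k + 1)) M a a' S ha' hc (hS (k + 1))) (hgrad (k + 1))
        (star_exposed L M S (k + 1) (two_le_lev_succ L hL k))

/-- **THE Ω-RESTRICTED FREE TOWER LAWS OF THE FAITHFUL STAR-BOND VECTOR OPERATOR `Δ_a(Ω₀)`, MODULO W1–W3**: every bookkeeping
field, the downward closure, the exposed faces and the defect majorant PROVED; displayed: ONE slice constant `c` for all levels (W1),
the gradient-form bound with its level-dependent constant `Cg k` (W2), the injected two-level law `e₁` (W3).
[cite: Balaban1985BackgroundPropagators, (3.26)–(3.27) p.395 (shape)] [folklore] -/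
theorem freeTowerLaws_star_of (hL : 2 ≤ L) (ha' : 0 < a') {c : ℝ} (hc : 0 < c)
    (hS : ∀ k, SliceCoercive (curlR (lev L k) M S) (gradR (lev L k) M S) (GOm (lev L k) M a' S) (QOm (lev L k) M S)
      (avgR (lev L k) M S) (a * ((lev L k : ℕ) : ℝ) ^ d) c)
    {Cg : ℕ → ℝ} (hCg : ∀ k, 0 ≤ Cg k)
    (hgrad : ∀ (k : ℕ) (ν : Fin d) (w : pidx L M (starP L M S) k → ℂ),
      nsq (fdiff (fine (lev L k) M) ((lev L k : ℕ) : ℂ) ν *ᵥ ext (starP L M S k) w)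
        ≤ Cg k * (star w ⬝ᵥ (regionDeltaA (lev L k) M a a' S *ᵥ w)).re)
    {e₁ : ℕ → ℝ}
    (hinj : ∀ k, ‖(regionDeltaA (lev L (k + 1)) M a a' S)⁻¹ * JpR L M (starP L M S) k
        - JpR L M (starP L M S) k * (regionDeltaA (lev L k) M a a' S)⁻¹‖ ≤ e₁ k) :
    FreeTowerLaws (fun k => regionDeltaA (lev L k) M a a' S) (QpR L M (starP L M S)) (JpR L M (starP L M S))
      (FpR L M (starP L M S)) ((L : ℝ) ^ d)
      (fun k => 2 * d * Real.sqrt (Cg (k + 1) * (gamStar d a' c)⁻¹) * ((L : ℝ)⁻¹) ^ k) e₁ (fStar L d (gamStar d a' c) Cg) :=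
  freeTowerLaws_sub_of L M (starP L M S) (fun k => regionDeltaA (lev L k) M a a' S) (star_down L M S)
    (fun k => regionDeltaA_isHermitian (lev L k) M a a' S) (gamStar_pos (d := d) a' hc) hCg
    (fun k => coercive_regionDeltaA_of_slice (lev L k) M a a' S ha' hc (hS k)) hgrad
    (opNorm_FstarR_mul_inv_le L M a a' S hL ha' hc hS hCg hgrad) hinj

/-- **CONVERGENCE OF THE STAR TOWER MODULO W1–W3 AT ANY GEOMETRIC RATE `θ < 1`** majorising the complement sequence, the defect
majorant `fStar` and the injected law. [folklore] -/
theorem towerLimitRate_star_of (hL : 2 ≤ L) (ha' : 0 < a') {c : ℝ} (hc : 0 < c)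
    (hS : ∀ k, SliceCoercive (curlR (lev L k) M S) (gradR (lev L k) M S) (GOm (lev L k) M a' S) (QOm (lev L k) M S)
      (avgR (lev L k) M S) (a * ((lev L k : ℕ) : ℝ) ^ d) c)
    {Cg : ℕ → ℝ} (hCg : ∀ k, 0 ≤ Cg k)
    (hgrad : ∀ (k : ℕ) (ν : Fin d) (w : pidx L M (starP L M S) k → ℂ),
      nsq (fdiff (fine (lev L k) M) ((lev L k : ℕ) : ℂ) ν *ᵥ ext (starP L M S k) w)
        ≤ Cg k * (star w ⬝ᵥ (regionDeltaA (lev L k) M a a' S *ᵥ w)).re)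
    {θ C₀ C₁ Cf : ℝ} (hθ1 : θ < 1)
    (h₀ : ∀ k, 2 * d * Real.sqrt (Cg (k + 1) * (gamStar d a' c)⁻¹) * ((L : ℝ)⁻¹) ^ k ≤ C₀ * θ ^ k)
    (hf : ∀ k, fStar L d (gamStar d a' c) Cg k ≤ Cf * θ ^ k)
    (hinj : ∀ k, ‖(regionDeltaA (lev L (k + 1)) M a a' S)⁻¹ * JpR L M (starP L M S) k
        - JpR L M (starP L M S) k * (regionDeltaA (lev L k) M a a' S)⁻¹‖ ≤ C₁ * θ ^ k) :
    TowerLimitRate (QpR L M (starP L M S)) ((L : ℝ) ^ d) (fun k => (regionDeltaA (lev L k) M a a' S)⁻¹)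
      (Cpert 0 C₀ C₁ 0 Cf 0) θ :=
  towerLimitRate_sub_of L M (starP L M S) (fun k => regionDeltaA (lev L k) M a a' S) (star_down L M S)
    (fun k => regionDeltaA_isHermitian (lev L k) M a a' S) (gamStar_pos (d := d) a' hc) hCg
    (fun k => coercive_regionDeltaA_of_slice (lev L k) M a a' S ha' hc (hS k)) hgrad
    (opNorm_FstarR_mul_inv_le L M a a' S hL ha' hc hS hCg hgrad) hθ1 h₀ hf hinj

/-- **THE RESOLVENT ROUTE OVER THE STAR TOWER** (modulo W1–W3): any compressed perturbation family with `PerturbationLaws`, `‖t‖κ < 1`.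
[folklore] -/
theorem towerLimitRate_star_perturbed_of (hL : 2 ≤ L) (ha' : 0 < a') {c : ℝ} (hc : 0 < c)
    (hS : ∀ k, SliceCoercive (curlR (lev L k) M S) (gradR (lev L k) M S) (GOm (lev L k) M a' S) (QOm (lev L k) M S)
      (avgR (lev L k) M S) (a * ((lev L k : ℕ) : ℝ) ^ d) c)
    {Cg : ℕ → ℝ} (hCg : ∀ k, 0 ≤ Cg k)
    (hgrad : ∀ (k : ℕ) (ν : Fin d) (w : pidx L M (starP L M S) k → ℂ),
      nsq (fdiff (fine (lev L k) M) ((lev L k : ℕ) : ℂ) ν *ᵥ ext (starP L M S k) w)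
        ≤ Cg k * (star w ⬝ᵥ (regionDeltaA (lev L k) M a a' S *ᵥ w)).re)
    {θ C₀ C₁ Cf : ℝ} (hθ1 : θ < 1)
    (h₀ : ∀ k, 2 * d * Real.sqrt (Cg (k + 1) * (gamStar d a' c)⁻¹) * ((L : ℝ)⁻¹) ^ k ≤ C₀ * θ ^ k)
    (hf : ∀ k, fStar L d (gamStar d a' c) Cg k ≤ Cf * θ ^ k)
    (hinj : ∀ k, ‖(regionDeltaA (lev L (k + 1)) M a a' S)⁻¹ * JpR L M (starP L M S) k
        - JpR L M (starP L M S) k * (regionDeltaA (lev L k) M a a' S)⁻¹‖ ≤ C₁ * θ ^ k)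
    {P : (k : ℕ) → Matrix (pidx L M (starP L M S) k) (pidx L M (starP L M S) k) ℂ} {κ C₂ : ℝ}
    (hpert : PerturbationLaws (fun k => regionDeltaA (lev L k) M a a' S) P (JpR L M (starP L M S)) κ (fun k => C₂ * θ ^ k))
    {t : ℂ} (ht : ‖t‖ * κ < 1) :
    TowerLimitRate (QpR L M (starP L M S)) ((L : ℝ) ^ d) (fun k => (regionDeltaA (lev L k) M a a' S + t • P k)⁻¹)
      (Cpert κ C₀ C₁ C₂ Cf t) θ :=
  towerLimitRate_sub_perturbed_of L M (starP L M S) (fun k => regionDeltaA (lev L k) M a a' S) (star_down L M S)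
    (fun k => regionDeltaA_isHermitian (lev L k) M a a' S) (gamStar_pos (d := d) a' hc) hCg
    (fun k => coercive_regionDeltaA_of_slice (lev L k) M a a' S ha' hc (hS k)) hgrad
    (opNorm_FstarR_mul_inv_le L M a a' S hL ha' hc hS hCg hgrad) hθ1 h₀ hf hinj hpert ht

/-! ### The linear-growth class of W2: rate `(√L)⁻¹` for the complement and defect sequences -/

omit [NeZero L] in
/-- `(√L)⁻¹`-geometry: `√(C·L^{k+1})·L^{−k} = √(C·L)·((√L)⁻¹)^k`. [folklore] -/
theorem sqrt_linear_mul_inv_pow (hL1 : 1 ≤ L) (C : ℝ) (k : ℕ) :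
    Real.sqrt (C * (L : ℝ) ^ (k + 1)) * ((L : ℝ)⁻¹) ^ k = Real.sqrt (C * L) * ((Real.sqrt L)⁻¹) ^ k := by
  have hLpos : (0 : ℝ) < L := by exact_mod_cast hL1
  have hsL : 0 < Real.sqrt L := Real.sqrt_pos.mpr hLpos
  have e1 : C * (L : ℝ) ^ (k + 1) = (C * L) * ((Real.sqrt L) ^ k) ^ 2 := by
    rw [← pow_mul, mul_comm k 2, pow_mul, Real.sq_sqrt hLpos.le]; ring
  have key : Real.sqrt L * (L : ℝ)⁻¹ = (Real.sqrt L)⁻¹ := by rw [← div_eq_mul_inv, Real.sqrt_div_self]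
  rw [e1, Real.sqrt_mul' _ (sq_nonneg _), Real.sqrt_sq (pow_nonneg hsL.le k), mul_assoc, ← mul_pow, key]

/-- **THE STAR TOWER UNDER LINEAR GROWTH OF W2**: if `Cg k ≤ Cg₀·L^k` and the injected law holds at a rate `θ` with `(√L)⁻¹ ≤ θ < 1`,
the averaged Green functions of `Δ_a(Ω₀)` CONVERGE at rate `θ` with constant `Cpert 0 C₀ C₁ 0 Cf 0`,
`C₀ = 2d√(Cg₀·L·γ⋆⁻¹)`, `Cf = γ⋆⁻¹ + √(d·Cg₀·L·γ⋆⁻¹)` — modulo W1 (one slice constant), W2 (in the linear-growth class) and W3.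
[cite: Balaban1985BackgroundPropagators, (3.26)–(3.27) p.395 (shape)] [folklore] -/
theorem towerLimitRate_star_of_linear (hL : 2 ≤ L) (ha' : 0 < a') {c : ℝ} (hc : 0 < c)
    (hS : ∀ k, SliceCoercive (curlR (lev L k) M S) (gradR (lev L k) M S) (GOm (lev L k) M a' S) (QOm (lev L k) M S)
      (avgR (lev L k) M S) (a * ((lev L k : ℕ) : ℝ) ^ d) c)
    {Cg : ℕ → ℝ} {Cg₀ : ℝ} (hCg : ∀ k, 0 ≤ Cg k) (hCg₀ : ∀ k, Cg k ≤ Cg₀ * (L : ℝ) ^ k)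
    (hgrad : ∀ (k : ℕ) (ν : Fin d) (w : pidx L M (starP L M S) k → ℂ),
      nsq (fdiff (fine (lev L k) M) ((lev L k : ℕ) : ℂ) ν *ᵥ ext (starP L M S k) w)
        ≤ Cg k * (star w ⬝ᵥ (regionDeltaA (lev L k) M a a' S *ᵥ w)).re)
    {θ C₁ : ℝ} (hθ : (Real.sqrt L)⁻¹ ≤ θ) (hθ1 : θ < 1)
    (hinj : ∀ k, ‖(regionDeltaA (lev L (k + 1)) M a a' S)⁻¹ * JpR L M (starP L M S) k
        - JpR L M (starP L M S) k * (regionDeltaA (lev L k) M a a' S)⁻¹‖ ≤ C₁ * θ ^ k) :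
    TowerLimitRate (QpR L M (starP L M S)) ((L : ℝ) ^ d) (fun k => (regionDeltaA (lev L k) M a a' S)⁻¹)
      (Cpert 0 (2 * d * Real.sqrt (Cg₀ * L * (gamStar d a' c)⁻¹)) C₁ 0
        ((gamStar d a' c)⁻¹ + Real.sqrt (d * (Cg₀ * L) * (gamStar d a' c)⁻¹)) 0) θ := by
  set γ := gamStar d a' c with hγdef
  have hγ : 0 < γ := gamStar_pos (d := d) a' hc
  have hL1 : 1 ≤ L := le_trans (by norm_num) hL
  have hL0 : (0 : ℝ) ≤ L := Nat.cast_nonneg L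
  have hsθ0 : 0 ≤ (Real.sqrt L)⁻¹ := inv_nonneg.mpr (Real.sqrt_nonneg _)
  have hθ0 : 0 ≤ θ := hsθ0.trans hθ
  have hpowθ : ∀ k, ((Real.sqrt L)⁻¹) ^ k ≤ θ ^ k := fun k => pow_le_pow_left₀ hsθ0 hθ k
  have hLθ : (L : ℝ)⁻¹ ≤ θ := by
    have hsL : 0 < Real.sqrt L := Real.sqrt_pos.mpr (by exact_mod_cast hL1)
    have h2 : Real.sqrt L * 1 ≤ Real.sqrt L * Real.sqrt L :=
      mul_le_mul_of_nonneg_left (Real.one_le_sqrt.mpr (by exact_mod_cast hL1)) hsL.le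
    rw [mul_one, Real.mul_self_sqrt hL0] at h2
    exact (inv_anti₀ hsL h2).trans hθ
  have h₀ : ∀ k, 2 * d * Real.sqrt (Cg (k + 1) * γ⁻¹) * ((L : ℝ)⁻¹) ^ k ≤ 2 * d * Real.sqrt (Cg₀ * L * γ⁻¹) * θ ^ k := by
    intro k
    have h1 : Real.sqrt (Cg (k + 1) * γ⁻¹) ≤ Real.sqrt ((Cg₀ * γ⁻¹) * (L : ℝ) ^ (k + 1)) :=
      Real.sqrt_le_sqrt (by
        have := mul_le_mul_of_nonneg_right (hCg₀ (k + 1)) (inv_nonneg.mpr hγ.le)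
        linarith [this])
    have h2 := sqrt_linear_mul_inv_pow L hL1 (Cg₀ * γ⁻¹) k
    have hLk : 0 ≤ ((L : ℝ)⁻¹) ^ k := pow_nonneg (inv_nonneg.mpr hL0) k
    calc 2 * d * Real.sqrt (Cg (k + 1) * γ⁻¹) * ((L : ℝ)⁻¹) ^ k
        ≤ 2 * d * Real.sqrt ((Cg₀ * γ⁻¹) * (L : ℝ) ^ (k + 1)) * ((L : ℝ)⁻¹) ^ k := by
          have : (0 : ℝ) ≤ 2 * d := by positivity
          exact mul_le_mul_of_nonneg_right (mul_le_mul_of_nonneg_left h1 this) hLk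
      _ = 2 * d * (Real.sqrt ((Cg₀ * γ⁻¹) * L) * ((Real.sqrt L)⁻¹) ^ k) := by rw [mul_assoc (2 * (d : ℝ)), h2]
      _ ≤ 2 * d * (Real.sqrt ((Cg₀ * γ⁻¹) * L) * θ ^ k) := by
          have : (0 : ℝ) ≤ 2 * d := by positivity
          exact mul_le_mul_of_nonneg_left (mul_le_mul_of_nonneg_left (hpowθ k) (Real.sqrt_nonneg _)) this
      _ = 2 * d * Real.sqrt (Cg₀ * L * γ⁻¹) * θ ^ k := by rw [mul_right_comm Cg₀ γ⁻¹ (L : ℝ)]; ring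
  have hf : ∀ k, fStar L d γ Cg k ≤ (γ⁻¹ + Real.sqrt (d * (Cg₀ * L) * γ⁻¹)) * θ ^ k := by
    intro k
    cases k with
    | zero =>
        simp only [fStar, pow_zero, mul_one]
        exact le_add_of_nonneg_right (Real.sqrt_nonneg _)
    | succ k =>
        simp only [fStar]
        have h1 : Real.sqrt (d * Cg (k + 1) * γ⁻¹) ≤ Real.sqrt ((d * Cg₀ * γ⁻¹) * (L : ℝ) ^ (k + 1)) :=
          Real.sqrt_le_sqrt (by
            have := mul_le_mul_of_nonneg_right (hCg₀ (k + 1)) (inv_nonneg.mpr hγ.le)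
            have hd : (0 : ℝ) ≤ d := Nat.cast_nonneg d
            nlinarith [this, hd])
        have h2 := sqrt_linear_mul_inv_pow L hL1 (d * Cg₀ * γ⁻¹) k
        have hLinv : ((L : ℝ) ^ (k + 1))⁻¹ = ((L : ℝ)⁻¹) ^ k * (L : ℝ)⁻¹ := by rw [← inv_pow, pow_succ]
        have hA : 0 ≤ Real.sqrt ((d * Cg₀ * γ⁻¹) * L) := Real.sqrt_nonneg _
        calc Real.sqrt (d * Cg (k + 1) * γ⁻¹) * ((L : ℝ) ^ (k + 1))⁻¹
            ≤ Real.sqrt ((d * Cg₀ * γ⁻¹) * (L : ℝ) ^ (k + 1)) * ((L : ℝ) ^ (k + 1))⁻¹ :=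
              mul_le_mul_of_nonneg_right h1 (inv_nonneg.mpr (pow_nonneg hL0 _))
          _ = Real.sqrt ((d * Cg₀ * γ⁻¹) * L) * ((Real.sqrt L)⁻¹) ^ k * (L : ℝ)⁻¹ := by rw [hLinv, ← mul_assoc, h2]
          _ ≤ Real.sqrt ((d * Cg₀ * γ⁻¹) * L) * θ ^ k * θ :=
              mul_le_mul (mul_le_mul_of_nonneg_left (hpowθ k) hA) hLθ (inv_nonneg.mpr hL0)
                (mul_nonneg hA (pow_nonneg hθ0 k))
          _ = Real.sqrt (d * (Cg₀ * L) * γ⁻¹) * θ ^ (k + 1) := by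
              rw [pow_succ, show (d : ℝ) * Cg₀ * γ⁻¹ * L = d * (Cg₀ * L) * γ⁻¹ by ring]; ring
          _ ≤ (γ⁻¹ + Real.sqrt (d * (Cg₀ * L) * γ⁻¹)) * θ ^ (k + 1) := by
              have : Real.sqrt (d * (Cg₀ * L) * γ⁻¹) ≤ γ⁻¹ + Real.sqrt (d * (Cg₀ * L) * γ⁻¹) :=
                le_add_of_nonneg_left (inv_nonneg.mpr hγ.le)
              exact mul_le_mul_of_nonneg_right this (pow_nonneg hθ0 (k + 1))
  exact towerLimitRate_star_of L M a a' S hL ha' hc hS hCg hgrad hθ1 h₀ hf hinj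

end End

end Summit.QuantumFields.BalabanUV.T4Continuum.DirichletStarVectorTower

end
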